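import Literature.NumberTheory.EllipticCurves.GeomReductionFrobeniusProofs
import HarnessLib

/-!
# `Frob_ℓ = −1` on a point of prime order `p ≠ ℓ` forces `p ∣ 1 + a_ℓ + ℓ` — dictionary (D2) of the split prime-conductor Chebotarev–Kummer supply (c′)
# (cell `bsd-stepL`, seat `bsd-stepL-corner3-p2` g14 = lane B, LINE OWNER of crux 21420 `CornerAtThreeW`; `--supports stmt-BirchSwinnertonDyer-21420 --as helper`)

WHY. The residual stub (c′) of `Cruxes/CornerAtThreeW/Lines/inert.lean` r18/r19 asks for an auxiliary prime `ℓ₀` with `¬ 3 ∣ a_{ℓ₀}(E) − 2`; the Chebotarev–Kummer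
argument (lane B g14 memo CORNER3-G14 §6–§7) produces `ℓ₀ ≡ 1 (mod 3)` whose arithmetic Frobenius acts as `−I` on `E[3]`. THIS FILE is the dictionary (D2):
**if an arithmetic Frobenius `σ` at a prime `𝔓 ∣ ℓ` of `ℚ̄` (good `ℓ`) negates ONE point `P ≠ O` of `E(ℚ̄)` of prime order `p ≠ ℓ`, then `p ∣ 1 + a_ℓ + ℓ`**
(`dvd_one_add_frobeniusTrace_add_of_smul_eq_neg`); in particular for `p = 3 ∣ ℓ − 1`: `3 ∤ a_ℓ − 2` (`not_three_dvd_frobeniusTrace_sub_two_of_smul_eq_neg`).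
Proof (one point suffices, no trace ∕ basis): reduce mod `𝔓` — `red(σ • P) = φ • red P` with `φ` the `ℓ`-power Frobenius (`geomReduction_smul_of_isArithFrobAt`,
Serre 1972 §1.11), `red P ≠ Õ` since the kernel of reduction has no prime-to-`ℓ` torsion (`eq_zero_of_smul_eq_zero_of_geomReduction_eq_zero`), so `φ Q = −Q` for
`Q = red P` of order `p`; Manin's relation `φ²Q − a_ℓ φQ + ℓQ = 0` (`frobenius_frobenius_sub_trace_smul_add_card_smul`, `frobeniusTrace_eq_sub_natCard_reductionModPrime`)
reads `(1 + a_ℓ + ℓ) Q = 0`, whence `p ∣ 1 + a_ℓ + ℓ` (Bezout).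
HONEST FRAMING: THEOREMS ONLY (no definition, no named fact, no `sorry`); nothing about any CM point or any crux object; no stub ∕ item closes; 21420 OPEN;
no census label moves (T7); BSD is proved for no curve.
References (locators only): [cite: Serre1972, §1.11 (1), Prop. 11] [cite: SilvermanAEC2009, V.2.3.1 (Frobenius satisfies φ² − aφ + q = 0), VII.3.1 (reduction injective on prime-to-p torsion)].
presearch: in-tree (`GeomReductionFrobeniusProofs`, `GeomPointReduction`, `SupersingularDensityDeuringCriterionProofs`). Axioms: `propext`, `Classical.choice`, `Quot.sound`.
-/

set_option autoImplicit false
set_option linter.dupNamespace false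

noncomputable section

open scoped Classical NumberField Pointwise
open IsDedekindDomain Field WeierstrassCurve

namespace Summit.BirchSwinnertonDyer.BirchSwinnertonDyer.Theorems.FrobeniusDictionary

open Literature.NumberTheory.EllipticCurves Literature.NumberTheory.GaloisRepresentations Rat.HeightOneSpectrum

/-- **(D2) `Frob = −1` on a point of prime order `p ≠ ℓ` ⟹ `p ∣ 1 + a_ℓ + ℓ`.** `W/ℚ` globally minimal elliptic, `ℓ ∤ Δ_W` (good reduction), `𝔓` the prime of `ℤ̄` of the
place over `ℓ`, `σ ∈ Γ_ℚ` an arithmetic Frobenius at `𝔓`, `P ∈ E(ℚ̄)` with `P ≠ O`, `p • P = O` for a prime `p ≠ ℓ`, and `σ • P = −P`. Then `p ∣ 1 + a_ℓ(W) + ℓ`.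
(Reduce: `φ Q = −Q` on `Q = red P ≠ Õ` of order `p`; Manin `φ²Q − a_ℓ φQ + ℓQ = 0` gives `(1 + a_ℓ + ℓ) Q = 0`.) [cite: Serre1972, §1.11 (1), Prop. 11]
[cite: SilvermanAEC2009, V.2.3.1, VII.3.1] -/
theorem dvd_one_add_frobeniusTrace_add_of_smul_eq_neg {ℓ : ℕ} [Fact ℓ.Prime] {W : WeierstrassCurve ℚ} [W.IsGloballyMinimal]
    [W.IsElliptic] (hΔ : ¬ (ℓ : ℤ) ∣ minimalDiscriminantInt W)
    {𝔓 : Ideal (absIntegers (𝓞 ℚ) ℚ)}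
    (hmem : ∀ x : absIntegers (𝓞 ℚ) ℚ, x ∈ 𝔓 ↔ (x : AlgebraicClosure ℚ) ∈ (placeOver ℓ).nonunits)
    {v : HeightOneSpectrum (𝓞 ℚ)} (hv : (primesEquiv v : ℕ) = ℓ) (h𝔓 : 𝔓 ∈ v.primesAbove)
    {σ : absoluteGaloisGroup ℚ} (hσ : IsArithFrobAt (𝓞 ℚ) σ 𝔓)
    {p : ℕ} (hp : p.Prime) (hpℓ : p ≠ ℓ) {P : W.geomPoints} (hP0 : P ≠ 0) (hpP : p • P = 0) (hσP : σ • P = -P) :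
    (p : ℤ) ∣ 1 + W.frobeniusTrace ℓ + ℓ := by
  have hℓ : ℓ.Prime := Fact.out
  haveI : (reductionModPrime W ℓ).IsElliptic := isElliptic_reductionModPrime W hΔ
  obtain ⟨φ, hφ⟩ := exists_frobenius_absoluteGaloisGroup (ZMod ℓ)
  have hφp : ∀ x : AlgebraicClosure (ZMod ℓ), φ • x = x ^ ℓ := by
    intro x; rw [hφ x, Nat.card_zmod]
  set Q := geomReduction hΔ P with hQ
  -- `Q ≠ 0`: the kernel of reduction has no `p`-torsion for `p ≠ ℓ`
  have hQ0 : Q ≠ 0 := by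
    intro h
    exact hP0 (eq_zero_of_smul_eq_zero_of_geomReduction_eq_zero hΔ
      (fun hd ↦ hpℓ ((Nat.prime_dvd_prime_iff_eq hℓ hp).mp hd).symm) hpP h)
  have hpQ : (p : ℤ) • Q = 0 := by
    rw [hQ, natCast_zsmul, ← map_nsmul, hpP, map_zero]
  -- `φ • Q = -Q`
  have hφQ : φ • Q = -Q := by
    rw [hQ, ← geomReduction_smul_of_isArithFrobAt hΔ hmem hv h𝔓 hσ hφp P, hσP, map_neg]
  -- Manin's relation at `Q`
  have hrel := (reductionModPrime W ℓ).frobenius_frobenius_sub_trace_smul_add_card_smul hφ Q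
  rw [Nat.card_zmod, ← frobeniusTrace_eq_sub_natCard_reductionModPrime W ℓ, hφQ] at hrel
  rw [smul_neg, hφQ, neg_neg, smul_neg, sub_neg_eq_add] at hrel
  -- `(1 + a_ℓ + ℓ) • Q = 0`
  have hn : (1 + W.frobeniusTrace ℓ + (ℓ : ℤ)) • Q = 0 := by
    rwa [add_zsmul, add_zsmul, one_zsmul]
  -- Bezout: `p ∤ n` would give `Q = 0`
  by_contra hnd
  have hcop : IsCoprime (p : ℤ) (1 + W.frobeniusTrace ℓ + (ℓ : ℤ)) :=
    (Prime.coprime_iff_not_dvd (Nat.prime_iff_prime_int.mp hp)).mpr hnd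
  obtain ⟨a, b, hab⟩ := hcop
  apply hQ0
  calc Q = (1 : ℤ) • Q := (one_zsmul Q).symm
    _ = (a * p + b * (1 + W.frobeniusTrace ℓ + (ℓ : ℤ))) • Q := by rw [hab]
    _ = 0 := by rw [add_zsmul, mul_zsmul, mul_zsmul, hpQ, hn, smul_zero, smul_zero, add_zero]

/-- **Corollary (p = 3, ℓ ≡ 1 mod 3): `3 ∤ a_ℓ − 2`** — the clause of (c′) at the auxiliary split prime: if an arithmetic Frobenius at `𝔓 ∣ ℓ` negates a point of order `3`
of `E(ℚ̄)` (`ℓ ≠ 3` good, `3 ∣ ℓ − 1`), then `a_ℓ ≡ −1 − ℓ ≡ −2 ≡ 1 (mod 3)`, so `3 ∤ a_ℓ − 2`. [cite: Serre1972, §1.11 (1)] [cite: SilvermanAEC2009, V.2.3.1] -/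
theorem not_three_dvd_frobeniusTrace_sub_two_of_smul_eq_neg {ℓ : ℕ} [Fact ℓ.Prime] {W : WeierstrassCurve ℚ} [W.IsGloballyMinimal]
    [W.IsElliptic] (hΔ : ¬ (ℓ : ℤ) ∣ minimalDiscriminantInt W)
    {𝔓 : Ideal (absIntegers (𝓞 ℚ) ℚ)}
    (hmem : ∀ x : absIntegers (𝓞 ℚ) ℚ, x ∈ 𝔓 ↔ (x : AlgebraicClosure ℚ) ∈ (placeOver ℓ).nonunits)
    {v : HeightOneSpectrum (𝓞 ℚ)} (hv : (primesEquiv v : ℕ) = ℓ) (h𝔓 : 𝔓 ∈ v.primesAbove)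
    {σ : absoluteGaloisGroup ℚ} (hσ : IsArithFrobAt (𝓞 ℚ) σ 𝔓)
    (hℓ3 : 3 ∣ ℓ - 1) {P : W.geomPoints} (hP0 : P ≠ 0) (h3P : 3 • P = 0) (hσP : σ • P = -P) :
    ¬ (3 : ℤ) ∣ W.frobeniusTrace ℓ - 2 := by
  have hℓ : ℓ.Prime := Fact.out
  have h3ℓ : (3 : ℕ) ≠ ℓ := by
    rintro rfl
    norm_num at hℓ3
  have h := dvd_one_add_frobeniusTrace_add_of_smul_eq_neg hΔ hmem hv h𝔓 hσ Nat.prime_three h3ℓ hP0 h3P hσP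
  intro h2
  have hℓ1 : (3 : ℤ) ∣ (ℓ : ℤ) - 1 := by
    have h1 : 1 ≤ ℓ := hℓ.one_lt.le
    have := Int.natCast_dvd_natCast.mpr hℓ3
    push_cast [Nat.cast_sub h1] at this
    exact this
  -- `3 ∣ (1 + a + ℓ) − (a − 2) − (ℓ − 1) = 4`, absurd
  have h4 : (3 : ℤ) ∣ 4 := by
    have := (h.sub h2).sub hℓ1
    have e : 1 + W.frobeniusTrace ℓ + (ℓ : ℤ) - (W.frobeniusTrace ℓ - 2) - ((ℓ : ℤ) - 1) = 4 := by ring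
    rw [e] at this
    exact_mod_cast this
  omega

end Summit.BirchSwinnertonDyer.BirchSwinnertonDyer.Theorems.FrobeniusDictionary

end
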